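import Mathlib
import Summits.NavierStokesRegularity.NavierStokesRegularity.Theorems.FilamentSkeletonRssStadiumSchwarzReflection

/-!
# Route `FilamentSkeletonRss` · child crux `TangentSkeletonNearStraightL` (stmt-NavierStokesRegularity-23320) · registered line
# `child_tangent_analytic_strip_L` (b0b56c52900dd90a), stub `stub_stripPropagation` — brick for R4: THE CHORD SQUARE IS LIPSCHITZ IN THE TARGET

Freeze step of the quarter-width tent (evidence `QUARTER-CONTOUR-CERTIFICATES-leafhand-15-g1.md` on 23320): the pointwise certificates give
`m ≤ Re(Σᵢ (Fᵢ z₀ − Fᵢ ζ)² + κG)` for the sources `ζ` of the contour of `z₀`; to reuse that contour for all targets `z` of a small ball one needs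
the chord square to move little with the target.  On the (convex) stadium with `‖F′‖ ≤ M`:
* `component_lipschitz` — `‖F z − F w‖ ≤ M‖z − w‖` (convexity: `Theorems.StadiumSchwarzReflection.convex_stadium`);
* `chord_sq_sub_chord_sq_le` — `‖Σᵢ (Fᵢ z − Fᵢ ζ)² − Σᵢ (Fᵢ z₀ − Fᵢ ζ)²‖ ≤ 3M²‖z − z₀‖(‖z − ζ‖ + ‖z₀ − ζ‖)`;
* `re_chord_sq_core_ge_of_near` — the margin persists: if `m ≤ Re(Σ(F z₀ − F ζ)² + κG)` and `3M²‖z − z₀‖(‖z − ζ‖ + ‖z₀ − ζ‖) ≤ m/2` then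
  `m/2 ≤ Re(Σ(F z − F ζ)² + κG)`.
HONEST FRAMING: a brick for a plan about a HYPOTHETICAL filament skeleton on the NEGATIVE side of a MODEL route; the stub `stub_stripPropagation` is NOT
closed by this file; nothing here bears on Navier–Stokes regularity or blow-up.  `--supports stmt-NavierStokesRegularity-23320`.
-/

set_option linter.dupNamespace false

noncomputable section

namespace Summit.NavierStokesRegularity.NavierStokesRegularity.Theorems.StadiumChordPerturb

open Set Metric
open scoped BigOperators
open Summit.NavierStokesRegularity.NavierStokesRegularity.Theorems.StadiumPartnerPiece
open Summit.NavierStokesRegularity.NavierStokesRegularity.Theorems.StadiumSchwarzReflection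

/-- **`F` is `M`-Lipschitz on the stadium** (mean value inequality on the convex stadium, `‖F′‖ ≤ M`), vector and component form. [folklore] -/
theorem component_lipschitz {hs L cc M : ℝ} {F : ℂ → (Fin 3 → ℂ)}
    (hF : DifferentiableOn ℂ F {z : ℂ | |z.im| < hs ∧ |z.re - cc| < L + hs})
    (hM : ∀ z ∈ {z : ℂ | |z.im| < hs ∧ |z.re - cc| < L + hs}, ‖deriv F z‖ ≤ M)
    {z w : ℂ} (hz : z ∈ {z : ℂ | |z.im| < hs ∧ |z.re - cc| < L + hs}) (hw : w ∈ {z : ℂ | |z.im| < hs ∧ |z.re - cc| < L + hs}) :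
    ‖F z - F w‖ ≤ M * ‖z - w‖ ∧ ∀ i, ‖F z i - F w i‖ ≤ M * ‖z - w‖ := by
  have hSo : IsOpen {z : ℂ | |z.im| < hs ∧ |z.re - cc| < L + hs} := isOpen_stadium hs (L + hs) cc
  have hdiff : ∀ x ∈ {z : ℂ | |z.im| < hs ∧ |z.re - cc| < L + hs}, DifferentiableAt ℂ F x :=
    fun x hx => hF.differentiableAt (hSo.mem_nhds hx)
  have h := (convex_stadium hs (L + hs) cc).norm_image_sub_le_of_norm_deriv_le hdiff hM hw hz
  refine ⟨h, fun i => ?_⟩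
  calc ‖F z i - F w i‖ = ‖(F z - F w) i‖ := by simp
    _ ≤ ‖F z - F w‖ := norm_le_pi_norm _ i
    _ ≤ M * ‖z - w‖ := h

/-- **The chord square is Lipschitz in the target.**  For `z, z₀, ζ` in the stadium (`‖F′‖ ≤ M`, `0 ≤ M`):
`‖Σᵢ (Fᵢ z − Fᵢ ζ)² − Σᵢ (Fᵢ z₀ − Fᵢ ζ)²‖ ≤ 3M²·‖z − z₀‖·(‖z − ζ‖ + ‖z₀ − ζ‖)`. [folklore] -/
theorem chord_sq_sub_chord_sq_le {hs L cc M : ℝ} {F : ℂ → (Fin 3 → ℂ)}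
    (hF : DifferentiableOn ℂ F {z : ℂ | |z.im| < hs ∧ |z.re - cc| < L + hs})
    (hM : ∀ z ∈ {z : ℂ | |z.im| < hs ∧ |z.re - cc| < L + hs}, ‖deriv F z‖ ≤ M) (hM0 : 0 ≤ M)
    {z z₀ ζ : ℂ} (hz : z ∈ {z : ℂ | |z.im| < hs ∧ |z.re - cc| < L + hs})
    (hz₀ : z₀ ∈ {z : ℂ | |z.im| < hs ∧ |z.re - cc| < L + hs}) (hζ : ζ ∈ {z : ℂ | |z.im| < hs ∧ |z.re - cc| < L + hs}) :
    ‖(∑ i, (F z i - F ζ i) ^ 2) - ∑ i, (F z₀ i - F ζ i) ^ 2‖ ≤ 3 * M ^ 2 * ‖z - z₀‖ * (‖z - ζ‖ + ‖z₀ - ζ‖) := by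
  have h1 := (component_lipschitz hF hM hz hz₀).2
  have h2 := (component_lipschitz hF hM hz hζ).2
  have h3 := (component_lipschitz hF hM hz₀ hζ).2
  rw [← Finset.sum_sub_distrib]
  have hterm : ∀ i, ‖(F z i - F ζ i) ^ 2 - (F z₀ i - F ζ i) ^ 2‖ ≤ M ^ 2 * ‖z - z₀‖ * (‖z - ζ‖ + ‖z₀ - ζ‖) := by
    intro i
    have e : (F z i - F ζ i) ^ 2 - (F z₀ i - F ζ i) ^ 2 = (F z i - F z₀ i) * ((F z i - F ζ i) + (F z₀ i - F ζ i)) := by ring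
    rw [e, norm_mul]
    have ha : ‖(F z i - F ζ i) + (F z₀ i - F ζ i)‖ ≤ M * ‖z - ζ‖ + M * ‖z₀ - ζ‖ :=
      (norm_add_le _ _).trans (add_le_add (h2 i) (h3 i))
    have hb : 0 ≤ M * ‖z - ζ‖ + M * ‖z₀ - ζ‖ := by positivity
    calc ‖F z i - F z₀ i‖ * ‖(F z i - F ζ i) + (F z₀ i - F ζ i)‖
        ≤ (M * ‖z - z₀‖) * (M * ‖z - ζ‖ + M * ‖z₀ - ζ‖) := mul_le_mul (h1 i) ha (norm_nonneg _) (by positivity)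
      _ = M ^ 2 * ‖z - z₀‖ * (‖z - ζ‖ + ‖z₀ - ζ‖) := by ring
  calc ‖∑ i, ((F z i - F ζ i) ^ 2 - (F z₀ i - F ζ i) ^ 2)‖
      ≤ ∑ i, ‖(F z i - F ζ i) ^ 2 - (F z₀ i - F ζ i) ^ 2‖ := norm_sum_le _ _
    _ ≤ ∑ _i : Fin 3, M ^ 2 * ‖z - z₀‖ * (‖z - ζ‖ + ‖z₀ - ζ‖) := Finset.sum_le_sum fun i _ => hterm i
    _ = 3 * M ^ 2 * ‖z - z₀‖ * (‖z - ζ‖ + ‖z₀ - ζ‖) := by simp; ring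

/-- **The margin persists near the target.**  If `m ≤ Re(Σᵢ (Fᵢ z₀ − Fᵢ ζ)² + C)` (any core term `C`) and
`3M²‖z − z₀‖(‖z − ζ‖ + ‖z₀ − ζ‖) ≤ m/2`, then `m/2 ≤ Re(Σᵢ (Fᵢ z − Fᵢ ζ)² + C)`. [folklore] -/
theorem re_chord_sq_core_ge_of_near {hs L cc M : ℝ} {F : ℂ → (Fin 3 → ℂ)}
    (hF : DifferentiableOn ℂ F {z : ℂ | |z.im| < hs ∧ |z.re - cc| < L + hs})
    (hM : ∀ z ∈ {z : ℂ | |z.im| < hs ∧ |z.re - cc| < L + hs}, ‖deriv F z‖ ≤ M) (hM0 : 0 ≤ M)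
    {z z₀ ζ : ℂ} (hz : z ∈ {z : ℂ | |z.im| < hs ∧ |z.re - cc| < L + hs})
    (hz₀ : z₀ ∈ {z : ℂ | |z.im| < hs ∧ |z.re - cc| < L + hs}) (hζ : ζ ∈ {z : ℂ | |z.im| < hs ∧ |z.re - cc| < L + hs})
    {C : ℂ} {m : ℝ} (hm : m ≤ ((∑ i, (F z₀ i - F ζ i) ^ 2) + C).re)
    (hnear : 3 * M ^ 2 * ‖z - z₀‖ * (‖z - ζ‖ + ‖z₀ - ζ‖) ≤ m / 2) :
    m / 2 ≤ ((∑ i, (F z i - F ζ i) ^ 2) + C).re := by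
  have h := chord_sq_sub_chord_sq_le hF hM hM0 hz hz₀ hζ
  have hre : |((∑ i, (F z i - F ζ i) ^ 2) - ∑ i, (F z₀ i - F ζ i) ^ 2).re| ≤ m / 2 :=
    (Complex.abs_re_le_norm _).trans (h.trans hnear)
  rw [Complex.sub_re] at hre
  have h1 := (abs_le.1 hre).1
  rw [Complex.add_re] at hm ⊢
  linarith

end Summit.NavierStokesRegularity.NavierStokesRegularity.Theorems.StadiumChordPerturb

end
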